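import Mathlib
import Summits.Ventures.HodgeRepro2.Tier7.Line1.SepWeightSimple

/-!
# Tier7/Line1/SepWeightFix — the «Fix» lemmas and `ℓ²`-membership for `Wmod s`

Continuation of `SepWeight` / `SepWeightSimple` (t7-L1-p2, LINE L1 residual probe — the SEPARATING DATUM). Proved:
* how the projections `proj n = (1 + Z_n)/2`, `projc n = (1 - Z_n)/2` see the levels: a level-`N` function of
  `Wmod 0` is fixed by `proj n` for `n ∉ N` (`proj_eq_self_of_level_zero`); for `s n ≠ 0` the only level-`N`
  function fixed by `proj n` is `0` (`eq_zero_of_proj_eq_self`); the relation `X_n π_n^- f = s n • π_n^+ f`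
  (`flip_projc_eq`) characterises the levels inside `Wmod s` (`mem_level_of_forall`), whence
  `Wmod 0 ⊓ Wmod s = ⊥` (`Wmod_zero_inf_eq_bot`) — these are the lemmas that separate `Wmod 0` from `Wmod s`;
* `ℓ²`-membership of every element of `Wmod s` when `∑ ‖s n‖² < ∞` (`memℓp_of_mem_Wmod`), and pointwise
  conjugation `conjF` preserves `Wmod s` for real `s`.
Author: t7-L1-p2 (prover-pub-hodge-repro2-t7-L1-p2-g0-0). §8(d): NO.
-/

namespace Summit.Ventures.HodgeRepro2.Tier7.Line1.Sep

open Finset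

noncomputable section

/-! ## The «Fix» lemmas: how the projections `proj n`, `projc n` see the levels -/

/-- the weight `0` vanishes on every non-empty configuration -/
theorem wt_zero_of_mem {ω : Ω} {n : ℕ} (hn : n ∈ ω) : wt (0 : ℕ → ℂ) ω = 0 :=
  Finset.prod_eq_zero hn rfl

/-- on `Wmod 0` (finitely supported functions) the level-`N` functions are fixed by `proj n`, `n ∉ N` -/
theorem proj_eq_self_of_level_zero {N : Finset ℕ} {f : Ω → ℂ} (hf : f ∈ level 0 N) {n : ℕ}
    (hn : n ∉ N) : proj n f = f := by
  obtain ⟨F, hF⟩ := hf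
  funext ω
  simp only [proj]
  split_ifs with h
  · rw [hF ω, wt_zero_of_mem (Finset.mem_sdiff.2 ⟨h, hn⟩), mul_zero]
  · rfl

/-- on `Wmod 0` the level-`N` functions are killed by `projc n`, `n ∉ N` -/
theorem projc_eq_zero_of_level_zero {N : Finset ℕ} {f : Ω → ℂ} (hf : f ∈ level 0 N) {n : ℕ}
    (hn : n ∉ N) : projc n f = 0 := by
  have h := proj_add_projc n f
  rw [proj_eq_self_of_level_zero hf hn] at h
  exact add_left_cancel (h.trans (add_zero f).symm)

/-- inserting `n ∉ N` does not change `· ∩ N` -/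
theorem inter_insert_of_notMem {ω N : Finset ℕ} {n : ℕ} (hn : n ∉ N) :
    insert n ω ∩ N = ω ∩ N := by
  ext x; simp only [mem_inter, mem_insert]
  constructor
  · rintro ⟨h1 | h1, h2⟩
    · exact absurd (h1 ▸ h2) hn
    · exact ⟨h1, h2⟩
  · rintro ⟨h1, h2⟩; exact ⟨Or.inr h1, h2⟩

/-- inserting `n ∉ N` inserts `n` into `· \ N` -/
theorem sdiff_insert_of_notMem {ω N : Finset ℕ} {n : ℕ} (hn : n ∉ N) :
    insert n ω \ N = insert n (ω \ N) := by
  ext x; simp only [mem_sdiff, mem_insert]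
  constructor
  · rintro ⟨h1 | h1, h2⟩
    · exact Or.inl h1
    · exact Or.inr ⟨h1, h2⟩
  · rintro (rfl | ⟨h1, h2⟩)
    · exact ⟨Or.inl rfl, hn⟩
    · exact ⟨Or.inr h1, h2⟩

/-- on a level-`N` function with `n ∉ N`: `f (insert n ω) = s n * f ω` -/
theorem level_apply_insert {s : ℕ → ℂ} {N : Finset ℕ} {f : Ω → ℂ} (hf : f ∈ level s N) {n : ℕ}
    (hn : n ∉ N) {ω : Ω} (hω : n ∉ ω) : f (insert n ω) = s n * f ω := by
  obtain ⟨F, hF⟩ := hf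
  rw [hF, hF ω, inter_insert_of_notMem hn, sdiff_insert_of_notMem hn,
    wt_insert s (fun h => hω (Finset.mem_sdiff.1 h).1)]
  ring

/-- the only level-`N` function (`s n ≠ 0`, `n ∉ N`) fixed by `proj n` is `0` -/
theorem eq_zero_of_proj_eq_self {s : ℕ → ℂ} {N : Finset ℕ} {f : Ω → ℂ} (hf : f ∈ level s N) {n : ℕ}
    (hs : s n ≠ 0) (hn : n ∉ N) (h : proj n f = f) : f = 0 := by
  funext ω
  by_cases hω : n ∈ ω
  · have := congrFun h ω
    simp only [proj, hω, if_true] at this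
    exact this.symm
  · have h1 := congrFun h (insert n ω)
    simp only [proj, mem_insert_self, if_true] at h1
    rw [level_apply_insert hf hn hω] at h1
    have : f ω = 0 := by
      rcases mul_eq_zero.1 h1.symm with h | h
      · exact absurd h hs
      · exact h
    exact this

/-- the relation `r_n f = 0`: `X_n π_n^- f = s n • π_n^+ f` on a level not seeing `n` -/
theorem flip_projc_eq {s : ℕ → ℂ} {N : Finset ℕ} {f : Ω → ℂ} (hf : f ∈ level s N) {n : ℕ}
    (hn : n ∉ N) : flip n (projc n f) = s n • proj n f := by
  funext ω
  simp only [flip, projc, proj, Pi.smul_apply, smul_eq_mul]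
  by_cases hω : n ∈ ω
  · have : n ∉ symmDiff ω {n} := by simp [Finset.mem_symmDiff, hω]
    simp [this, hω]
  · have h1 : n ∈ symmDiff ω {n} := by simp [Finset.mem_symmDiff, hω]
    have h2 : symmDiff ω {n} = insert n ω := by
      ext x; simp only [Finset.mem_symmDiff, mem_singleton, mem_insert]
      rcases eq_or_ne x n with rfl | hx
      · simp [hω]
      · simp [hx]
    simp only [h1, if_true, hω, if_false]
    rw [h2, level_apply_insert hf hn hω]

/-- peeling: if a level-`N` function satisfies the relation at `n ∈ N`, it is of level `N.erase n` -/
theorem level_erase_of_flip_projc_eq {s : ℕ → ℂ} {N : Finset ℕ} {f : Ω → ℂ} (hf : f ∈ level s N) {n : ℕ}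
    (hn : n ∈ N) (h : flip n (projc n f) = s n • proj n f) : f ∈ level s (N.erase n) := by
  obtain ⟨F, hF⟩ := hf
  have key : ∀ ω, n ∉ ω → f (insert n ω) = s n * f ω := by
    intro ω hω
    have h1 := congrFun h ω
    simp only [flip, projc, proj, Pi.smul_apply, smul_eq_mul, hω, if_false] at h1
    have h2 : n ∈ symmDiff ω {n} := by simp [Finset.mem_symmDiff, hω]
    have h3 : symmDiff ω {n} = insert n ω := by
      ext x; simp only [Finset.mem_symmDiff, mem_singleton, mem_insert]
      rcases eq_or_ne x n with rfl | hx
      · simp [hω]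
      · simp [hx]
    rw [if_pos h2, h3] at h1
    exact h1
  refine ⟨F, fun ω => ?_⟩
  by_cases hω : n ∈ ω
  · have hω' : n ∉ ω.erase n := Finset.notMem_erase n ω
    have e1 : insert n (ω.erase n) = ω := Finset.insert_erase hω
    have e2 : ω ∩ N.erase n = ω.erase n ∩ N := by
      ext x; simp only [mem_inter, mem_erase]; tauto
    have e3 : ω \ N.erase n = insert n (ω.erase n \ N) := by
      ext x; simp only [mem_sdiff, mem_erase, mem_insert]
      rcases eq_or_ne x n with rfl | hx
      · simp [hω]
      · simp [hx]
    have e4 : n ∉ ω.erase n \ N := fun h => hω' (Finset.mem_sdiff.1 h).1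
    rw [← e1, key _ hω', hF, e1, e2, e3, wt_insert s e4]
    ring
  · have e2 : ω ∩ N.erase n = ω ∩ N := by
      ext x; simp only [mem_inter, mem_erase]
      constructor
      · rintro ⟨h1, _, h2⟩; exact ⟨h1, h2⟩
      · rintro ⟨h1, h2⟩; exact ⟨h1, fun hx => hω (hx ▸ h1), h2⟩
    have e3 : ω \ N.erase n = ω \ N := by
      ext x; simp only [mem_sdiff, mem_erase]
      constructor
      · rintro ⟨h1, h2⟩; exact ⟨h1, fun hx => h2 ⟨fun hx' => hω (hx' ▸ h1), hx⟩⟩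
      · rintro ⟨h1, h2⟩; exact ⟨h1, fun hx => h2 hx.2⟩
    rw [hF ω, e2, e3]

/-- the level of `f` can be cut down along any set of relations -/
theorem level_sdiff_of_forall {s : ℕ → ℂ} {N : Finset ℕ} {f : Ω → ℂ} (hf : f ∈ level s N)
    (D : Finset ℕ) (h : ∀ n ∈ D, flip n (projc n f) = s n • proj n f) : f ∈ level s (N \ D) := by
  induction D using Finset.induction_on with
  | empty => simpa using hf
  | insert m D _ ih =>
    have ih' := ih fun n hn => h n (mem_insert_of_mem hn)
    rw [Finset.sdiff_insert]
    by_cases hm : m ∈ N \ D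
    · exact level_erase_of_flip_projc_eq ih' hm (h m (mem_insert_self m D))
    · rw [Finset.erase_eq_of_notMem hm]; exact ih'

/-- the «Fix» characterisation of the levels inside `Wmod s` -/
theorem mem_level_of_forall {s : ℕ → ℂ} {N : Finset ℕ} {f : Ω → ℂ} (hf : f ∈ Wmod s)
    (h : ∀ n ∉ N, flip n (projc n f) = s n • proj n f) : f ∈ level s N := by
  obtain ⟨N', hN'⟩ := mem_Wmod_iff.1 hf
  have := level_sdiff_of_forall hN' (N' \ N) fun n hn => h n (Finset.mem_sdiff.1 hn).2
  rw [Finset.sdiff_sdiff_self_left] at this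
  exact level_mono Finset.inter_subset_right this

/-- `Wmod 0` and `Wmod s` (`s` nowhere zero) are independent -/
theorem Wmod_zero_inf_eq_bot {s : ℕ → ℂ} (hs : ∀ n, s n ≠ 0) : Wmod 0 ⊓ Wmod s = ⊥ := by
  rw [eq_bot_iff]
  rintro f ⟨hf0, hfs⟩
  obtain ⟨N₀, hN₀⟩ := mem_Wmod_iff.1 hf0
  obtain ⟨N₁, hN₁⟩ := mem_Wmod_iff.1 hfs
  obtain ⟨n, hn⟩ := Infinite.exists_notMem_finset (N₀ ∪ N₁)
  have hn0 : n ∉ N₀ := fun h => hn (mem_union_left _ h)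
  have hn1 : n ∉ N₁ := fun h => hn (mem_union_right _ h)
  rw [Submodule.mem_bot]
  exact eq_zero_of_proj_eq_self hN₁ (hs n) hn1 (proj_eq_self_of_level_zero hN₀ hn0)


/-! ## `ℓ²`-membership of the level functions -/

/-- `∑_ω ∏_{n ∈ ω} t n = ∏_n (1 + t n) < ∞` for a summable non-negative `t` -/
theorem summable_prod_of_summable {t : ℕ → ℝ} (ht : ∀ n, 0 ≤ t n) (hs : Summable t) :
    Summable (fun ω : Finset ℕ => ∏ n ∈ ω, t n) := by
  refine summable_of_sum_le (c := Real.exp (∑' n, t n)) (fun ω => Finset.prod_nonneg fun n _ => ht n)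
    fun u => ?_
  set N : Finset ℕ := u.sup id with hN
  have hu : u ⊆ N.powerset := by
    intro ω hω
    exact Finset.mem_powerset.2 (Finset.le_sup (f := id) hω)
  calc ∑ ω ∈ u, ∏ n ∈ ω, t n ≤ ∑ ω ∈ N.powerset, ∏ n ∈ ω, t n :=
        Finset.sum_le_sum_of_subset_of_nonneg hu fun ω _ _ => Finset.prod_nonneg fun n _ => ht n
    _ = ∏ n ∈ N, (1 + t n) := (Finset.prod_one_add N).symm
    _ ≤ ∏ n ∈ N, Real.exp (t n) :=
        Finset.prod_le_prod (fun n _ => by linarith [ht n]) fun n _ => by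
          linarith [Real.add_one_le_exp (t n)]
    _ = Real.exp (∑ n ∈ N, t n) := (Real.exp_sum N t).symm
    _ ≤ Real.exp (∑' n, t n) := Real.exp_le_exp.2 (hs.sum_le_tsum N (fun n _ => ht n))

/-- the majorant of the level-`N` functions -/
theorem norm_chi_sq_le (s : ℕ → ℂ) (N A : Finset ℕ) (ω : Ω) :
    ‖chi s N A ω‖ ^ 2 ≤ ∏ n ∈ ω, (if n ∈ N then (1 : ℝ) else ‖s n‖ ^ 2) := by
  have h0 : 0 ≤ ∏ n ∈ ω, (if n ∈ N then (1 : ℝ) else ‖s n‖ ^ 2) :=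
    Finset.prod_nonneg fun n _ => by split_ifs <;> positivity
  simp only [chi]
  split_ifs with h
  · rw [norm_wt, ← Finset.prod_pow, Finset.prod_ite, Finset.prod_const_one, one_mul]
    rw [← Finset.sdiff_eq_filter]
  · simpa using h0

/-- the majorant is summable -/
theorem summable_majorant {s : ℕ → ℂ} (hs : Summable fun n => ‖s n‖ ^ 2) (N : Finset ℕ) :
    Summable (fun n => if n ∈ N then (1 : ℝ) else ‖s n‖ ^ 2) := by
  have h1 : Summable (fun n => if n ∈ N then (1 : ℝ) else 0) :=
    summable_of_ne_finset_zero (s := N) fun n hn => by simp [hn]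
  refine Summable.of_nonneg_of_le (fun n => by split_ifs <;> positivity) (fun n => ?_) (h1.add hs)
  split_ifs <;> simp

/-- every elementary level function is square-summable -/
theorem memℓp_chi {s : ℕ → ℂ} (hs : Summable fun n => ‖s n‖ ^ 2) (N A : Finset ℕ) :
    Memℓp (chi s N A) 2 := by
  rw [memℓp_gen_iff (by norm_num)]
  simp only [ENNReal.toReal_ofNat, Real.rpow_two]
  exact Summable.of_nonneg_of_le (fun ω => by positivity) (norm_chi_sq_le s N A)
    (summable_prod_of_summable (fun n => by split_ifs <;> positivity) (summable_majorant hs N))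

/-- every level function is square-summable -/
theorem memℓp_of_mem_level {s : ℕ → ℂ} (hs : Summable fun n => ‖s n‖ ^ 2) {N : Finset ℕ} {f : Ω → ℂ}
    (hf : f ∈ level s N) : Memℓp f 2 := by
  obtain ⟨F, hF⟩ := hf
  have hf' : f = fun ω => ∑ A ∈ N.powerset, (F A • chi s N A) ω := by
    funext ω; rw [eq_sum_chi hF, Finset.sum_apply]
  rw [hf']
  exact Memℓp.finsetSum _ fun A _ => (memℓp_chi hs N A).const_smul (F A)

/-- every element of `Wmod s` is square-summable -/
theorem memℓp_of_mem_Wmod {s : ℕ → ℂ} (hs : Summable fun n => ‖s n‖ ^ 2) {f : Ω → ℂ}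
    (hf : f ∈ Wmod s) : Memℓp f 2 := by
  obtain ⟨N, hN⟩ := mem_Wmod_iff.1 hf
  exact memℓp_of_mem_level hs hN

/-! ## Conjugation -/

/-- pointwise complex conjugation -/
def conjF (f : Ω → ℂ) : Ω → ℂ := fun ω => (starRingEnd ℂ) (f ω)

/-- conjugation preserves the levels of a real weight -/
theorem conjF_mem_level {s : ℕ → ℂ} (hs : ∀ n, (starRingEnd ℂ) (s n) = s n) {N : Finset ℕ} {f : Ω → ℂ}
    (hf : f ∈ level s N) : conjF f ∈ level s N := by
  obtain ⟨F, hF⟩ := hf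
  refine ⟨fun A => (starRingEnd ℂ) (F A), fun ω => ?_⟩
  simp only [conjF, hF ω, map_mul, wt, map_prod, hs]

/-- conjugation preserves `Wmod s` for a real weight -/
theorem conjF_mem_Wmod {s : ℕ → ℂ} (hs : ∀ n, (starRingEnd ℂ) (s n) = s n) {f : Ω → ℂ}
    (hf : f ∈ Wmod s) : conjF f ∈ Wmod s := by
  obtain ⟨N, hN⟩ := mem_Wmod_iff.1 hf
  exact level_le_Wmod s N (conjF_mem_level hs hN)

/-- conjugation is an involution -/
theorem conjF_conjF (f : Ω → ℂ) : conjF (conjF f) = f := by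
  funext ω; simp [conjF]

/-- conjugation is additive -/
theorem conjF_add (f g : Ω → ℂ) : conjF (f + g) = conjF f + conjF g := by
  funext ω; simp [conjF]

/-- conjugation is antilinear -/
theorem conjF_smul (c : ℂ) (f : Ω → ℂ) : conjF (c • f) = (starRingEnd ℂ) c • conjF f := by
  funext ω; simp [conjF]

/-- conjugation commutes with the flips -/
theorem conjF_flip (n : ℕ) (f : Ω → ℂ) : conjF (flip n f) = flip n (conjF f) := by
  funext ω; simp [conjF, flip]

/-- conjugation commutes with the signs -/
theorem conjF_sgn (n : ℕ) (f : Ω → ℂ) : conjF (sgn n f) = sgn n (conjF f) := by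
  funext ω; simp only [conjF, sgn, map_mul]; split_ifs <;> simp

end

end Summit.Ventures.HodgeRepro2.Tier7.Line1.Sep
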